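import Summits.QuantumFields.GaugeBoot.StaggeredCentralTwist
import HarnessLib

/-!
# Staggerings from mod-2 parities; link reflection positivity at every real `β` under a central
# involution with `ρ z = -1` (gauge-boot, L3 structural supplement, part 2 of 3)

HONEST FRAMING (cell `pub-gaugeboot`, page 1 of every file): the venture produces certified bounds
on lattice expectations at stated coupling, gauge group, dimension and torus size; NOT a mass gap,
NOT a continuum limit, NOT a string tension; NOT Yang–Mills-summit-bearing (barriers
`FixedCouplingUltralocality`, `PerturbativeInvisibility`). This module bounds no expectation; no
certificate of the cell sits at `β < 0`.

Part 1 (`StaggeredCentralTwist.lean`) showed that a staggering `IsStaggering e z s` (central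
involutive link weights with product `z` around every plaquette) twists the Wilson measure at `β`
onto the one at `-β` when `ρ z = -1`. Here the staggering is CONSTRUCTED — the Kogut–Susskind
phases written multiplicatively: given additive mod-2 parities `π_m : A →+ ℤ/2` dual to the marked
translations (`π_m(e_k) = [m = k]`; on the even cubic torus `x ↦ x_m mod 2`) and a chosen axis `r`,
order the axes with `r` LAST (`PrecLast r`) and put `c(x, m) = ∑_{m' ≺ m} π_{m'}(x)`,
`s(x, m) = z^{c(x, m)}` (`stagParity`, `stagTwist`). Then

* `stagParity_plaquette` — the sign rule `c₁ + c₂ + c₃ + c₄ = 1` around every plaquette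
  (`c(x + e_k, m) = c(x, m) + [k ≺ m]` and trichotomy of `≺`), whence `isStaggering_stagTwist`;
* `stagParity_siteLinkMap`, `stagParity_midLinkMap`, `centralTwist_configReflect`,
  `centralTwist_configMidReflect` — since no parity `π_{m'}`, `m' ≠ r`, sees `e_r`, the twist
  COMMUTES with the lane's site reflection `configReflect e r σ` AND link reflection
  `configMidReflect e r σ` of any site frame along `r` whose reflection `σ` preserves the parities
  off `r` (`π_m ∘ σ = π_m`, `m ≠ r`);
* ★★ `IsSiteFrame.linkRP_integral_conj_mul_nonneg_anyBeta_of_twist` — LINK (mid-plane) REFLECTION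
  POSITIVITY AT EVERY REAL `β` on a finite periodic lattice with a site frame along `r` and such
  parities, for a compact second countable `G` with a central `z`, `z² = 1`, and a continuous `ρ`
  with `ρ z = -1`: `β ≥ 0` is `linkRP_integral_conj_mul_nonneg` (`TiltedLinkRPPositivity.lean`),
  `β < 0` is carried onto `-β > 0` by the twist, which preserves the half-space observable class
  (`isMidObservable_comp_centralTwist`); PSD blocks
  `linkRP_sum_mul_conj_integral_nonneg_anyBeta_of_twist`.

What is NOT claimed: nothing for groups without such a `z` (`SU(3)`, `SU(2n+1)`: link RP at
`β < 0` neither proved nor refuted); nothing for the DIAGONAL family at `β < 0` (no swap-symmetric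
staggering exists: the four links of the plaquette at a site of the mirror are exchanged in pairs);
nothing about infinite volume. Structural; NOT a bound on any expectation.

References: J. Kogut, L. Susskind, Phys. Rev. D 11 (1975) 395 (staggered phases); L. Li,
Y. Meurice, Phys. Rev. D 71 (2005) 016008 §II; K. Osterwalder, E. Seiler, Ann. Phys. 110 (1978) 440
§2; E. Seiler, LNP 159 (1982) Ch. 2; V. Kazakov, Z. Zheng, arXiv:2203.11360 §3.1.
-/

noncomputable section

open MeasureTheory Complex
open scoped ComplexOrder ComplexConjugate
open Literature.MathematicalPhysics.QuantumFieldTheory (haarProbability)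
open Literature.RepresentationTheory.CompactGroups

namespace Summit.QuantumFields.GaugeBoot

namespace TiltedRP

variable {A : Type*} [AddCommGroup A] {d N : ℕ} {G : Type*} [Group G]

/-! ## Staggerings from mod-2 coordinate parities (Kogut–Susskind phases, one axis last) -/

section Parity

variable (e : Fin d → A)

/-- **Dual parities** of the marked translations: additive `π_m : A →+ ℤ/2` with
`π_m(e_k) = [m = k]` (on the cubic torus of even side: `x ↦ x_m mod 2`).
[shape] A hypothesis (a `Prop`), asserting nothing. [folklore] -/
def IsDualParity (π : Fin d → A →+ ZMod 2) : Prop := ∀ m k, π m (e k) = if m = k then 1 else 0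

/-- The strict total order of the axes with `r` LAST: `m' ≺ m` iff `m' ≠ r` and (`m = r` or
`m' < m`). [shape] A definition, asserting nothing. [folklore] -/
abbrev PrecLast (r m' m : Fin d) : Prop := m' ≠ r ∧ (m = r ∨ m' < m)

omit [AddCommGroup A] in
/-- `≺` is trichotomous: for `k ≠ l` exactly one of `k ≺ l`, `l ≺ k` holds. -/
theorem precLast_xor {r k l : Fin d} (hkl : k ≠ l) : PrecLast r k l ↔ ¬PrecLast r l k := by
  unfold PrecLast
  by_cases hk : k = r
  · subst hk
    have hl : l ≠ k := fun h => hkl h.symm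
    simp [hl]
  · by_cases hl : l = r
    · subst hl
      simp [hk]
    · simp only [ne_eq, hk, not_false_eq_true, hl, false_or, true_and, not_lt]
      exact ⟨fun h => h.le, fun h => lt_of_le_of_ne h hkl⟩

/-- **The staggered parity of a link**: `c(x, m) = ∑_{m' ≺ m} π_{m'}(x)`. -/
def stagParity (π : Fin d → A →+ ZMod 2) (r : Fin d) (l : Link A d) : ZMod 2 :=
  ∑ m' ∈ Finset.univ.filter (fun m' => PrecLast r m' l.2), π m' l.1

/-- `z^a` for `a ∈ ℤ/2`. -/
def zpow₂ (z : G) (a : ZMod 2) : G := if a = 1 then z else 1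

/-- **The staggered central twist weights** `s(l) = z^{c(l)}`. -/
def stagTwist (π : Fin d → A →+ ZMod 2) (r : Fin d) (z : G) (l : Link A d) : G :=
  zpow₂ z (stagParity π r l)

omit [AddCommGroup A] in
/-- `z^{a+b} = z^a z^b` for `z² = 1`. -/
theorem zpow₂_add {z : G} (hz2 : z * z = 1) (a b : ZMod 2) :
    zpow₂ z (a + b) = zpow₂ z a * zpow₂ z b := by
  have hcases : ∀ a : ZMod 2, a = 0 ∨ a = 1 := by decide
  have h11 : (1 : ZMod 2) + 1 = 0 := by decide
  have h01 : (0 : ZMod 2) ≠ 1 := by decide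
  unfold zpow₂
  rcases hcases a with rfl | rfl <;> rcases hcases b with rfl | rfl <;> simp [h11, h01, hz2]

variable {e}
variable {π : Fin d → A →+ ZMod 2} (hπ : IsDualParity e π) (r : Fin d)
include hπ

/-- Translating the base point by `e_k` adds `[k ≺ m]` to the parity of an `m`-link. -/
theorem stagParity_add_e (x : A) (k m : Fin d) :
    stagParity π r (x + e k, m) = stagParity π r (x, m) + if PrecLast r k m then 1 else 0 := by
  have hπ' : ∀ m', π m' (e k) = if m' = k then 1 else 0 := fun m' => hπ m' k
  unfold stagParity
  simp only [map_add, Finset.sum_add_distrib, hπ', Finset.sum_ite_eq', Finset.mem_filter,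
    Finset.mem_univ, true_and]

/-- **The Kogut–Susskind sign rule**: around every plaquette the four staggered parities sum to `1`. -/
theorem stagParity_plaquette (x : A) {k l : Fin d} (hkl : k ≠ l) :
    stagParity π r (x, k) + stagParity π r (x + e k, l) + stagParity π r (x + e l, k) +
      stagParity π r (x, l) = 1 := by
  rw [stagParity_add_e hπ, stagParity_add_e hπ]
  have h2 : ∀ a : ZMod 2, a + a = 0 := by decide
  by_cases h : PrecLast r k l
  · have h' : ¬PrecLast r l k := (precLast_xor hkl).1 h
    rw [if_pos h, if_neg h']
    linear_combination (h2 (stagParity π r (x, k))) + (h2 (stagParity π r (x, l)))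
  · have h' : PrecLast r l k := by
      by_contra h'; exact h ((precLast_xor hkl).2 h')
    rw [if_neg h, if_pos h']
    linear_combination (h2 (stagParity π r (x, k))) + (h2 (stagParity π r (x, l)))

/-- **The staggered weights are a staggering** with value `z` (central `z`, `z² = 1`). -/
theorem isStaggering_stagTwist {z : G} (hzc : ∀ g, z * g = g * z) (hz2 : z * z = 1) :
    IsStaggering e z (stagTwist π r z) where
  comm l g := by
    unfold stagTwist zpow₂
    split_ifs
    · exact hzc g
    · rw [one_mul, mul_one]
  mul_self l := by
    unfold stagTwist zpow₂
    split_ifs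
    · exact hz2
    · exact one_mul 1
  plaq x k l hkl := by
    unfold stagTwist
    rw [← zpow₂_add hz2, ← zpow₂_add hz2, ← zpow₂_add hz2, stagParity_plaquette hπ r x hkl]
    simp [zpow₂]

/-! ### Commutation with the reflections of a site frame along the last axis `r` -/

variable {σ : A →+ A} (hπσ : ∀ m, m ≠ r → ∀ x, π m (σ x) = π m x)
include hπσ

/-- The staggered parity is invariant under the site-reflection link map of axis `r`. -/
theorem stagParity_siteLinkMap (l : Link A d) :
    stagParity π r (siteLinkMap e r σ l) = stagParity π r l := by
  obtain ⟨x, m⟩ := l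
  unfold stagParity siteLinkMap
  refine Finset.sum_congr rfl fun m' hm' => ?_
  simp only [Finset.mem_filter, Finset.mem_univ, true_and] at hm'
  have hm'r : m' ≠ r := hm'.1
  split_ifs
  · rw [map_add, map_neg, hπ, if_neg hm'r, neg_zero, add_zero, hπσ m' hm'r]
  · rw [add_zero, hπσ m' hm'r]

/-- The staggered parity is invariant under the mid-plane (link) reflection link map of axis `r`. -/
theorem stagParity_midLinkMap (l : Link A d) :
    stagParity π r (midLinkMap e r σ l) = stagParity π r l := by
  obtain ⟨x, m⟩ := l
  unfold stagParity midLinkMap midReflect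
  refine Finset.sum_congr rfl fun m' hm' => ?_
  simp only [Finset.mem_filter, Finset.mem_univ, true_and] at hm'
  have hm'r : m' ≠ r := hm'.1
  split_ifs
  · rw [map_add, map_add, map_neg, hπ, if_neg hm'r, neg_zero, add_zero, add_zero, hπσ m' hm'r]
  · rw [add_zero, map_add, hπ, if_neg hm'r, add_zero, hπσ m' hm'r]

/-- **The twist commutes with the site reflection `Θ'` of axis `r`.** -/
theorem centralTwist_configReflect {z : G} (hzc : ∀ g, z * g = g * z) (hz2 : z * z = 1)
    (U : Config A d G) :
    centralTwist (stagTwist π r z) (configReflect e r σ U) =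
      configReflect e r σ (centralTwist (stagTwist π r z) U) := by
  have hs := isStaggering_stagTwist hπ r hzc hz2
  funext l
  unfold configReflect
  simp only [centralTwist_apply]
  have hw : stagTwist π r z (siteLinkMap e r σ l) = stagTwist π r z l := by
    unfold stagTwist; rw [stagParity_siteLinkMap hπ r hπσ]
  split_ifs with hl
  · rw [mul_inv_rev, hs.inv_eq, hw, hs.comm]
  · rw [hw]

/-- **The twist commutes with the link (mid-plane) reflection `Θ` of axis `r`.** -/
theorem centralTwist_configMidReflect {z : G} (hzc : ∀ g, z * g = g * z) (hz2 : z * z = 1)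
    (U : Config A d G) :
    centralTwist (stagTwist π r z) (configMidReflect e r σ U) =
      configMidReflect e r σ (centralTwist (stagTwist π r z) U) := by
  have hs := isStaggering_stagTwist hπ r hzc hz2
  funext l
  unfold configMidReflect
  simp only [centralTwist_apply]
  have hw : stagTwist π r z (midLinkMap e r σ l) = stagTwist π r z l := by
    unfold stagTwist; rw [stagParity_midLinkMap hπ r hπσ]
  split_ifs with hl
  · rw [mul_inv_rev, hs.inv_eq, hw, hs.comm]
  · rw [hw]

end Parity

/-! ## Link reflection positivity at every real `β` under a central involution with `ρ z = -1` -/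

namespace IsSiteFrame

variable [Fintype A] {e : Fin d → A} {r : Fin d} {σ : A →+ A} {Q : ℕ} {h : A →+ ZMod (2 * Q)}
variable (hF : IsSiteFrame e r σ Q h)
variable [TopologicalSpace G] [IsTopologicalGroup G] [CompactSpace G] [MeasurableSpace G] [BorelSpace G]
  [SecondCountableTopology G]
variable (ρ : G →* Matrix (Fin N) (Fin N) ℂ)
include hF

omit hF [Fintype A] [TopologicalSpace G] [IsTopologicalGroup G] [CompactSpace G] [MeasurableSpace G]
  [BorelSpace G] [SecondCountableTopology G] in
/-- Half-space (`{1 ≤ h ≤ Q}`) observables stay half-space observables under a link-wise twist. -/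
theorem isMidObservable_comp_centralTwist (s : Link A d → G) {F : Config A d G → ℂ}
    (hFo : IsMidObservable e Q h F) : IsMidObservable e Q h fun U => F (centralTwist s U) :=
  fun U V hUV => hFo _ _ fun l hl => by rw [centralTwist_apply, centralTwist_apply, hUV l hl]

/-- ★★ **Link (mid-plane) reflection positivity at EVERY real `β`** on a finite periodic lattice with
a site frame along `r` and dual mod-2 parities even under the frame's reflection off the axis `r`,
for a compact second countable `G` with a central `z`, `z² = 1`, and a continuous `ρ` with
`ρ z = -1`: for every bounded measurable observable `F` of the closed half `{1 ≤ h ≤ Q}`,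
`0 ≤ ∫ conj F(ΘU) F(U) dμ_β(U)` — `β ≥ 0` by `linkRP_integral_conj_mul_nonneg`, `β < 0` by the
staggered central twist onto `-β > 0`. -/
theorem linkRP_integral_conj_mul_nonneg_anyBeta_of_twist {π : Fin d → A →+ ZMod 2}
    (hπ : IsDualParity e π) (hπσ : ∀ m, m ≠ r → ∀ x, π m (σ x) = π m x) {z : G}
    (hzc : ∀ g, z * g = g * z) (hz2 : z * z = 1) (hρ : Continuous ρ) (hρz : ρ z = -1) (β : ℝ)
    (F : Config A d G → ℂ) (hFm : Measurable F) (hFb : ∃ C : ℝ, ∀ U, ‖F U‖ ≤ C)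
    (hFo : IsMidObservable e Q h F) :
    0 ≤ ∫ U, conj (F (configMidReflect e r σ U)) * F U ∂(gibbs ρ e β) := by
  rcases le_or_gt 0 β with hβ | hβ
  · exact hF.linkRP_integral_conj_mul_nonneg ρ hρ hβ F hFm hFb hFo
  · obtain ⟨γ, rfl⟩ : ∃ γ, β = -γ := ⟨-β, (neg_neg β).symm⟩
    have hs := isStaggering_stagTwist hπ r hzc hz2
    rw [hs.integral_conj_mul_gibbs_neg_eq ρ hρz γ
      (fun U => centralTwist_configMidReflect hπ r hπσ hzc hz2 U) F]
    obtain ⟨C, hC⟩ := hFb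
    exact hF.linkRP_integral_conj_mul_nonneg ρ hρ (by linarith) (fun U => F (centralTwist _ U))
      (hFm.comp (measurable_centralTwist _)) ⟨C, fun U => hC _⟩
      (isMidObservable_comp_centralTwist _ hFo)

/-- **The link RP blocks are positive semidefinite at every real `β`** (same hypotheses): for
bounded measurable half-space observables `F_1, …, F_n` and `c ∈ ℂ^n`,
`0 ≤ ∑_{a,b} conj c_a · c_b · ∫ conj(F_a(ΘU)) F_b(U) dμ_β`. -/
theorem linkRP_sum_mul_conj_integral_nonneg_anyBeta_of_twist {π : Fin d → A →+ ZMod 2}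
    (hπ : IsDualParity e π) (hπσ : ∀ m, m ≠ r → ∀ x, π m (σ x) = π m x) {z : G}
    (hzc : ∀ g, z * g = g * z) (hz2 : z * z = 1) (hρ : Continuous ρ) (hρz : ρ z = -1) (β : ℝ)
    {n : ℕ} (F : Fin n → Config A d G → ℂ) (hFm : ∀ a, Measurable (F a))
    (hFb : ∀ a, ∃ C : ℝ, ∀ U, ‖F a U‖ ≤ C) (hFo : ∀ a, IsMidObservable e Q h (F a)) (c : Fin n → ℂ) :
    0 ≤ ∑ a, ∑ b, conj (c a) * c b *
      ∫ U, conj (F a (configMidReflect e r σ U)) * F b U ∂(gibbs ρ e β) := by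
  rcases le_or_gt 0 β with hβ | hβ
  · exact hF.linkRP_sum_mul_conj_integral_nonneg ρ hρ hβ F hFm hFb hFo c
  · obtain ⟨γ, rfl⟩ : ∃ γ, β = -γ := ⟨-β, (neg_neg β).symm⟩
    have hs := isStaggering_stagTwist hπ r hzc hz2
    simp_rw [hs.integral_conj_mul_gibbs_neg_eq₂ ρ hρz γ
      (fun U => centralTwist_configMidReflect hπ r hπσ hzc hz2 U)]
    refine hF.linkRP_sum_mul_conj_integral_nonneg ρ hρ (by linarith)
      (fun a U => F a (centralTwist _ U)) (fun a => (hFm a).comp (measurable_centralTwist _))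
      (fun a => ?_) (fun a => isMidObservable_comp_centralTwist _ (hFo a)) c
    obtain ⟨C, hC⟩ := hFb a
    exact ⟨C, fun U => hC _⟩

end IsSiteFrame

end TiltedRP

end Summit.QuantumFields.GaugeBoot
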